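import Summits.QuantumFields.YangMills.Theorems.BalabanLadderIRColdPurityBridge
import Literature.MathematicalPhysics.QuantumFieldTheory.WilsonFinTorusPartitionComplex
import HarnessLib

/-!
# The cold purity defect is continuous in the coupling (helper for crux `BalabanLadder.IR`, stmt-QuantumFields-19354)

Landed under RULING g9-№2 (director-ym g9, 2026-08-28T03:27:38Z: «idea-12's S `DefectContinuous` … land now») from the
ideator line `coupling-clopen` (seat ym-ir-idea-12 g0; workfile `Cruxes/IR/Lines/coupling_clopen.lean`, stub S discharged).

* `continuous_wilsonFinTorusPartition` — for a continuous representation `ρ` of a second-countable compact group, the Wilson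
  partition function of the anisotropic four-torus `β ↦ Z_β(n₀,n₁,n₂,n₃)` is continuous on `ℝ`: it is the real restriction
  (`wilsonFinTorusPartitionC_ofReal`) of the ENTIRE complex partition function (`differentiable_wilsonFinTorusPartitionC`).
* `continuous_coldDefect` — for a `LatticeRep`, `β ↦ δᶜ_β(L) = 1 − Z_β(L,L,L,2⌊L/4⌋)/Z_β(L,L,L,⌊L/4⌋)²`
  (`ColdPurityBridge.coldDefect`) is continuous (`Z_β > 0`, `wilsonFinTorusPartition_pos`).

Use: the set of couplings at which a fixed torus is `ε`-pure is OPEN ∕ the set where it is `ε`-impure-or-equal is CLOSED — the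
topological ingredient of the coupling-axis transports `allExit_of_clopen` (line `coupling-clopen`) and of compactness arguments
on coupling ranges.  HONESTY: nothing here bears on the Yang–Mills mass gap (Clay) or proves any open item; R4 closes only the
conditional finite-𝕋⁴ rung `BalabanLadder.UV`.
-/

noncomputable section

open MeasureTheory
open Literature.MathematicalPhysics.QuantumFieldTheory Literature.MathematicalPhysics.QuantumLattice
open Summit.QuantumFields.YangMills.Cruxes.IR.ColdPurityBridge (coldDefect)

namespace Summit.QuantumFields.YangMills.Cruxes.IR.CouplingAxis

variable {G : Type} [Group G] [TopologicalSpace G] [IsTopologicalGroup G] [CompactSpace G]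
  [MeasurableSpace G] [BorelSpace G]

/-- **The Wilson partition function of a fixed anisotropic torus is continuous in the coupling** (continuous `ρ`,
second-countable `G`): real restriction of the entire complex partition function. -/
theorem continuous_wilsonFinTorusPartition [SecondCountableTopology G] {N : ℕ} (ρ : G →* Matrix (Fin N) (Fin N) ℂ)
    (hρ : Continuous ρ) (n₀ n₁ n₂ n₃ : ℕ) :
    Continuous fun β : ℝ => wilsonFinTorusPartition ρ β n₀ n₁ n₂ n₃ := by
  have hd : Continuous fun z : ℂ => wilsonFinTorusPartitionC ρ z n₀ n₁ n₂ n₃ :=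
    (differentiable_wilsonFinTorusPartitionC ρ hρ n₀ n₁ n₂ n₃).continuous
  have h2 : Continuous fun β : ℝ => (wilsonFinTorusPartitionC ρ (β : ℂ) n₀ n₁ n₂ n₃).re :=
    Complex.continuous_re.comp (hd.comp Complex.continuous_ofReal)
  refine h2.congr fun β => ?_
  rw [wilsonFinTorusPartitionC_ofReal, Complex.ofReal_re]

/-- **The cold purity defect of a fixed torus is continuous in the coupling**: `β ↦ δᶜ_β(L)` is continuous on `ℝ`
for every `LatticeRep` `r` and every `L`. -/
theorem continuous_coldDefect (r : LatticeRep G) (L : ℕ) : Continuous fun β : ℝ => coldDefect r.ρ β L := by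
  haveI : SecondCountableTopology G :=
    (r.continuous.isClosedEmbedding r.injective).isEmbedding.secondCountableTopology
  have hZ : ∀ m : ℕ, Continuous fun β : ℝ => wilsonFinTorusPartition r.ρ β L L L m := fun m =>
    continuous_wilsonFinTorusPartition r.ρ r.continuous L L L m
  have hpos : ∀ (m : ℕ) (β : ℝ), wilsonFinTorusPartition r.ρ β L L L m ≠ 0 := fun m β =>
    (wilsonFinTorusPartition_pos r.continuous β L L L m).ne'
  unfold coldDefect
  exact continuous_const.sub ((hZ _).div ((hZ _).pow 2) fun β => pow_ne_zero 2 (hpos _ β))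

/-- **Sublevel sets in the coupling are closed**: `{β | δᶜ_β(L) ≤ ε}` is closed. -/
theorem isClosed_setOf_coldDefect_le (r : LatticeRep G) (L : ℕ) (ε : ℝ) :
    IsClosed {β : ℝ | coldDefect r.ρ β L ≤ ε} :=
  isClosed_le (continuous_coldDefect r L) continuous_const

/-- **Strict sublevel sets in the coupling are open**: `{β | δᶜ_β(L) < ε}` is open. -/
theorem isOpen_setOf_coldDefect_lt (r : LatticeRep G) (L : ℕ) (ε : ℝ) :
    IsOpen {β : ℝ | coldDefect r.ρ β L < ε} :=
  isOpen_lt (continuous_coldDefect r L) continuous_const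

end Summit.QuantumFields.YangMills.Cruxes.IR.CouplingAxis

end
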